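import Summits.AtomisticToContinuum.FouriersLaw.Theses.HonestZwanzig
import Summits.AtomisticToContinuum.FouriersLaw.Theorems.HonestZwanzigNetworkReductionPackage
import Summits.AtomisticToContinuum.FouriersLaw.Theorems.HonestZwanzigFeshbachIdentitiesLaplacePositivity

/-!
# `HonestZwanzig.RobinCoercivity` (crux stmt-AtomisticToContinuum-12695) — negative lemmas, part 1: Schur positivity

Refuter / crux-disprover support file (`--supports stmt-AtomisticToContinuum-12695`). Fixed `N`, fixed Laplace variable
`s > 0`, the route's gadgets `corr`, `lap_s`, `cov`, `e_x`, `Adm` as abstract variables with their defining equations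
(exactly as in `…NetworkReductionPackage` and the lead's skeleton `Cruxes/RobinCoercivity/Lines/LinAlg.lean`), under the
fixed-`N` package `hFI` (= route item `FeshbachIdentities`, stmt-AtomisticToContinuum-12697):

* `lap_sum_right'`, `sum_schur_left`, `sum_schur_right`, `sum_sum_schur_eq_schur_sum` — bilinearity of the Schur pairing
  `schur_s(f,g) = lap_s(f,g) − Σ_{u,v} lap_s(f,e_u)(G⁻¹)_{uv} lap_s(e_v,g)` (any matrix `G`);
* `schur_self_nonneg` — **the orthogonal-dynamics resolvent is positive on the diagonal**: `schur_s(g,g) ≥ 0` for every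
  admissible `g` when `G = G(s) = [lap_s(e_x,e_y)]` has positive quadratic form: with `b'_v = lap_s(e_v,g)`, `a = −G⁻¹b'`,
  `U = g + Σ_u a_u e_u` one has `schur_s(g,g) = lap_s(U,U) = ⟨Ũ, R_sŨ⟩_μ ≥ s‖R_sŨ‖² ≥ 0` (landed
  `pinnedChain_lap_self_eq_centred`, `pinnedChain_integral_mul_resolvent_ge`).

Part 2 (`…Negative.ContactCeiling`) turns this into the contact ceiling `1ᵀ𝔽_N(s)1 ≤ s·1ᵀCov(e,e)1 + 2γT²`, the bound
`c ≤ γT²` on every admissible Robin constant, and three refuted strengthenings of the crux.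
-/

noncomputable section

open MeasureTheory Finset Matrix
open Literature.MathematicalPhysics.KineticTheory.HeatConduction
open Summit.AtomisticToContinuum.FouriersLaw.Theses.HonestZwanzig
open Summit.AtomisticToContinuum.FouriersLaw.Theorems.HonestZwanzig
open Summit.AtomisticToContinuum.FouriersLaw.Theorems.HonestZwanzig.NetworkReduction

namespace Summit.AtomisticToContinuum.FouriersLaw.Theorems.RobinCoercivity.Negative

/-! ### Fixed `N`, fixed `s`: abstract gadgets with their defining equations (as in `…NetworkReductionPackage`) -/

section FixedN

variable {ω₂ lam β γ : ℝ} {N : ℕ} {T : ℝ}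
  {Adm : (PhaseSpace N → ℝ) → Prop}
  {corr : (PhaseSpace N → ℝ) → (PhaseSpace N → ℝ) → ℝ → ℝ}
  {lap : ℝ → (PhaseSpace N → ℝ) → (PhaseSpace N → ℝ) → ℝ}
  {cov : (PhaseSpace N → ℝ) → (PhaseSpace N → ℝ) → ℝ}
  {e : Fin N → PhaseSpace N → ℝ}
  (hAdm : ∀ f, Adm f ↔ (Continuous f ∧ ∃ A : ℝ, ∀ z,
    |f z| ≤ A * Real.exp ((pinnedChain ω₂ lam β γ).hamiltonian N z / (8 * T))))
  (hcorr : ∀ f g t, corr f g t =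
    (∫ z, f z * (∫ y, g y ∂((pinnedChain ω₂ lam β γ).transitionKernel N T T t.toNNReal z))
      ∂(pinnedChain ω₂ lam β γ).gibbsMeasure N T) -
    (∫ z, f z ∂(pinnedChain ω₂ lam β γ).gibbsMeasure N T) *
      (∫ z, g z ∂(pinnedChain ω₂ lam β γ).gibbsMeasure N T))
  (hlap : ∀ s f g, lap s f g = ∫ t in Set.Ioi (0 : ℝ), Real.exp (-(s * t)) * corr f g t)
  (hcov : ∀ f g, cov f g = (∫ z, f z * g z ∂(pinnedChain ω₂ lam β γ).gibbsMeasure N T) -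
    (∫ z, f z ∂(pinnedChain ω₂ lam β γ).gibbsMeasure N T) *
      (∫ z, g z ∂(pinnedChain ω₂ lam β γ).gibbsMeasure N T))
  (he : ∀ x z, e x z = z.2 x ^ 2 / 2 + (pinnedChain ω₂ lam β γ).U (z.1 x) +
    ∑ j : Fin N, ((if j.val = x.val + 1 then (pinnedChain ω₂ lam β γ).V (z.1 j - z.1 x) / 2 else 0) +
      (if x.val = j.val + 1 then (pinnedChain ω₂ lam β γ).V (z.1 x - z.1 j) / 2 else 0)))
  (hFI : ∀ f g : PhaseSpace N → ℝ, Adm f → Adm g →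
    Integrable f ((pinnedChain ω₂ lam β γ).gibbsMeasure N T) ∧
    (∀ t : ℝ, 0 ≤ t → Integrable (fun z => f z *
      (∫ y, g y ∂((pinnedChain ω₂ lam β γ).transitionKernel N T T t.toNNReal z)))
      ((pinnedChain ω₂ lam β γ).gibbsMeasure N T)) ∧
    IntegrableOn (corr f g) (Set.Ioi 0) ∧
    (∀ t : ℝ, 0 ≤ t → corr f g t = corr (fun z => g (z.1, -z.2)) (fun z => f (z.1, -z.2)) t) ∧
    (∀ s : ℝ, 0 < s → ∀ x : Fin N,
      s * lap s (e x) g - cov (e x) g =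
        lap s (fun z => (pinnedChain ω₂ lam β γ).generator N T T (e x) (z.1, -z.2)) g ∧
      s * lap s f (e x) - cov f (e x) = lap s f ((pinnedChain ω₂ lam β γ).generator N T T (e x))))
  (hGSE : ∀ (x : Fin N) (z : PhaseSpace N), (pinnedChain ω₂ lam β γ).generator N T T (e x) z =
    (∑ b : Fin N, ((if x.val = b.val + 1 then (pinnedChain ω₂ lam β γ).bondCurrent N b z else 0) -
      (if b = x then (pinnedChain ω₂ lam β γ).bondCurrent N b z else 0))) +
    (if x.val = 0 then (pinnedChain ω₂ lam β γ).γ * (T - z.2 x ^ 2) else 0) +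
    (if x.val = N - 1 then (pinnedChain ω₂ lam β γ).γ * (T - z.2 x ^ 2) else 0))
  (hPS : ∀ x y : Fin N, cov (e x) ((pinnedChain ω₂ lam β γ).generator N T T (e y)) =
    -(if x = y ∧ (x.val = 0 ∨ x.val = N - 1) then (pinnedChain ω₂ lam β γ).γ * T ^ 2 else 0))
  (hω : 0 < ω₂) (hl : 0 ≤ lam) (hβ : 0 ≤ β) (hγ : 0 ≤ γ) (hT : 0 < T)

include hAdm hcorr hlap hFI hω hl hβ hT in
/-- Unweighted finite sums in the SECOND slot of `lap_s`, `s ≥ 0` (time reversal of `lap_sum_left'`). -/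
theorem lap_sum_right' {ι : Type*} (S : Finset ι) (gs : ι → PhaseSpace N → ℝ)
    (hgs : ∀ i ∈ S, Adm (gs i)) {f : PhaseSpace N → ℝ} (hf : Adm f) {s : ℝ} (hs : 0 ≤ s) :
    lap s f (fun z => ∑ i ∈ S, gs i z) = ∑ i ∈ S, lap s f (gs i) := by
  have hsum : Adm (fun z => ∑ i ∈ S, gs i z) :=
    adm_sum Adm hAdm S gs (adm_const Adm hAdm hω hl hβ hT 0) hgs
  rw [lap_rev hlap hFI hf hsum]
  have hfun : (fun z : PhaseSpace N => ∑ i ∈ S, gs i (z.1, -z.2)) =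
      fun z => ∑ i ∈ S, (fun w : PhaseSpace N => gs i (w.1, -w.2)) z := rfl
  rw [hfun, lap_sum_left' hAdm hcorr hlap hFI hω hl hβ hT S (fun i w => gs i (w.1, -w.2))
    (fun i hi => adm_rev Adm hAdm (hgs i hi)) (adm_rev Adm hAdm hf) hs]
  refine Finset.sum_congr rfl fun i hi => ?_
  rw [← lap_rev hlap hFI hf (hgs i hi)]

include hAdm hcorr hlap he hFI hω hl hβ hT in
/-- Linearity of the Schur pairing in the FIRST slot: `Σ_i schur_s(f_i, g) = schur_s(Σ_i f_i, g)` for admissible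
`f_i, g`, where `schur_s(f,g) = lap_s(f,g) − Σ_{u,v} lap_s(f,e_u) (G⁻¹)_{uv} lap_s(e_v,g)` for ANY matrix `G`. -/
theorem sum_schur_left {s : ℝ} (hs : 0 ≤ s) (G : Matrix (Fin N) (Fin N) ℝ)
    (schur : (PhaseSpace N → ℝ) → (PhaseSpace N → ℝ) → ℝ)
    (hschur : ∀ f g, schur f g = lap s f g - ∑ u, ∑ v, lap s f (e u) * G⁻¹ u v * lap s (e v) g)
    {ι : Type*} (S : Finset ι) (fs : ι → PhaseSpace N → ℝ) (hfs : ∀ i ∈ S, Adm (fs i))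
    {g : PhaseSpace N → ℝ} (hg : Adm g) :
    ∑ i ∈ S, schur (fs i) g = schur (fun z => ∑ i ∈ S, fs i z) g := by
  have hex : ∀ x, Adm (e x) := fun x => adm_e Adm hAdm e he hω hl hβ hT x
  rw [hschur, lap_sum_left' hAdm hcorr hlap hFI hω hl hβ hT S fs hfs hg hs]
  have h2 : ∀ u, lap s (fun z => ∑ i ∈ S, fs i z) (e u) = ∑ i ∈ S, lap s (fs i) (e u) :=
    fun u => lap_sum_left' hAdm hcorr hlap hFI hω hl hβ hT S fs hfs (hex u) hs
  simp only [h2, hschur, Finset.sum_sub_distrib, Finset.sum_mul]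
  congr 1
  rw [Finset.sum_comm]
  refine Finset.sum_congr rfl fun u _ => ?_
  rw [Finset.sum_comm]

include hAdm hcorr hlap he hFI hω hl hβ hT in
/-- Linearity of the Schur pairing in the SECOND slot: `Σ_k schur_s(f, g_k) = schur_s(f, Σ_k g_k)`. -/
theorem sum_schur_right {s : ℝ} (hs : 0 ≤ s) (G : Matrix (Fin N) (Fin N) ℝ)
    (schur : (PhaseSpace N → ℝ) → (PhaseSpace N → ℝ) → ℝ)
    (hschur : ∀ f g, schur f g = lap s f g - ∑ u, ∑ v, lap s f (e u) * G⁻¹ u v * lap s (e v) g)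
    {κ : Type*} (R : Finset κ) (gs : κ → PhaseSpace N → ℝ) (hgs : ∀ k ∈ R, Adm (gs k))
    {f : PhaseSpace N → ℝ} (hf : Adm f) :
    ∑ k ∈ R, schur f (gs k) = schur f (fun z => ∑ k ∈ R, gs k z) := by
  have hex : ∀ x, Adm (e x) := fun x => adm_e Adm hAdm e he hω hl hβ hT x
  rw [hschur, lap_sum_right' hAdm hcorr hlap hFI hω hl hβ hT R gs hgs hf hs]
  have h3 : ∀ v, lap s (e v) (fun z => ∑ k ∈ R, gs k z) = ∑ k ∈ R, lap s (e v) (gs k) :=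
    fun v => lap_sum_right' hAdm hcorr hlap hFI hω hl hβ hT R gs hgs (hex v) hs
  simp only [h3, hschur, Finset.sum_sub_distrib, Finset.mul_sum]
  congr 1
  rw [Finset.sum_comm]
  refine Finset.sum_congr rfl fun u _ => ?_
  rw [Finset.sum_comm]

include hAdm hcorr hlap he hFI hω hl hβ hT in
/-- **Bilinearity of the Schur pairing**: `Σ_x Σ_y schur_s(f_x, g_y) = schur_s(Σ_x f_x, Σ_y g_y)` for admissible
families (any matrix `G` in the definition of `schur_s`). -/
theorem sum_sum_schur_eq_schur_sum {s : ℝ} (hs : 0 ≤ s) (G : Matrix (Fin N) (Fin N) ℝ)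
    (schur : (PhaseSpace N → ℝ) → (PhaseSpace N → ℝ) → ℝ)
    (hschur : ∀ f g, schur f g = lap s f g - ∑ u, ∑ v, lap s f (e u) * G⁻¹ u v * lap s (e v) g)
    {ι κ : Type*} (S : Finset ι) (R : Finset κ) (fs : ι → PhaseSpace N → ℝ) (gs : κ → PhaseSpace N → ℝ)
    (hfs : ∀ i ∈ S, Adm (fs i)) (hgs : ∀ k ∈ R, Adm (gs k)) :
    ∑ i ∈ S, ∑ k ∈ R, schur (fs i) (gs k) = schur (fun z => ∑ i ∈ S, fs i z) (fun z => ∑ k ∈ R, gs k z) := by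
  have hgsum : Adm (fun z => ∑ k ∈ R, gs k z) :=
    adm_sum Adm hAdm R gs (adm_const Adm hAdm hω hl hβ hT 0) hgs
  have h1 : ∀ i ∈ S, ∑ k ∈ R, schur (fs i) (gs k) = schur (fs i) (fun z => ∑ k ∈ R, gs k z) :=
    fun i _ => sum_schur_right hAdm hcorr hlap he hFI hω hl hβ hT hs G schur hschur R gs hgs (hfs i ‹_›)
  rw [Finset.sum_congr rfl h1]
  exact sum_schur_left hAdm hcorr hlap he hFI hω hl hβ hT hs G schur hschur S fs hfs hgsum

/-- An admissible observable is nice with weight `ϑ = 1/(8T)` and a nonnegative constant. -/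
theorem adm_nice (hAdm : ∀ f, Adm f ↔ (Continuous f ∧ ∃ A : ℝ, ∀ z,
    |f z| ≤ A * Real.exp ((pinnedChain ω₂ lam β γ).hamiltonian N z / (8 * T))))
    {f : PhaseSpace N → ℝ} (hf : Adm f) :
    Continuous f ∧ ∃ C : ℝ, 0 ≤ C ∧ ∀ z,
      |f z| ≤ C * Real.exp ((1 / (8 * T)) * (pinnedChain ω₂ lam β γ).hamiltonian N z) := by
  rw [hAdm] at hf
  obtain ⟨hfc, A, hA⟩ := hf
  refine ⟨hfc, max A 0, le_max_right _ _, fun z => ?_⟩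
  have h1 := hA z
  have h2 : (pinnedChain ω₂ lam β γ).hamiltonian N z / (8 * T) =
      (1 / (8 * T)) * (pinnedChain ω₂ lam β γ).hamiltonian N z := by ring
  rw [← h2]
  exact h1.trans (mul_le_mul_of_nonneg_right (le_max_left _ _) (Real.exp_pos _).le)

include hAdm hcorr hlap he hFI hω hl hβ hT in
/-- **`schur_s(g, g) ≥ 0`** for admissible `g`, `s > 0`, `β, γ > 0`, `N ≥ 1`: with `b'_v = lap_s(e_v, g)`,
`a = −G(s)⁻¹ b'` and `U = g + Σ_u a_u e_u` one has `schur_s(g,g) = lap_s(U,U) = ⟨Ũ, R_s Ũ⟩_μ ≥ s ‖R_s Ũ‖² ≥ 0`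
(`G(s)` symmetric with positive quadratic form, hence invertible). -/
theorem schur_self_nonneg (hβ' : 0 < β) (hγ' : 0 < γ) (hN : 0 < N) {s : ℝ} (hs : 0 < s)
    (G : Matrix (Fin N) (Fin N) ℝ) (hG : ∀ x y, G x y = lap s (e x) (e y))
    (hGp : ∀ v : Fin N → ℝ, v ≠ 0 → 0 < ∑ x, ∑ y, v x * G x y * v y)
    (schur : (PhaseSpace N → ℝ) → (PhaseSpace N → ℝ) → ℝ)
    (hschur : ∀ f g, schur f g = lap s f g - ∑ u, ∑ v, lap s f (e u) * G⁻¹ u v * lap s (e v) g)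
    {g : PhaseSpace N → ℝ} (hg : Adm g) : 0 ≤ schur g g := by
  classical
  have hex : ∀ x, Adm (e x) := fun x => adm_e Adm hAdm e he hω hl hβ hT x
  have hGsym : ∀ x y, G x y = G y x := fun x y => by
    rw [hG, hG, pkg_G_symm hAdm hlap he hFI hω hl hβ hT s]
  have hGpd : G.PosDef := posDef_of_symm_of_pos G hGsym hGp
  have hGunit : IsUnit G.det := (Matrix.isUnit_iff_isUnit_det G).mp hGpd.isUnit
  -- the optimal coefficients
  set b' : Fin N → ℝ := fun v => lap s (e v) g with hb'
  set a : Fin N → ℝ := -(G⁻¹ *ᵥ b') with ha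
  have hGa : G *ᵥ a = -b' := by
    rw [ha, Matrix.mulVec_neg, Matrix.mulVec_mulVec, Matrix.mul_nonsing_inv G hGunit, Matrix.one_mulVec]
  have hGa' : ∀ u, ∑ v, G u v * a v = -b' u := fun u => by
    have := congrFun hGa u
    simpa [Matrix.mulVec, dotProduct] using this
  -- the combination `U = g + Σ a_u e_u`
  set U : PhaseSpace N → ℝ := fun z => g z + ∑ u, a u * e u z with hU
  have hUs : Adm (fun z => ∑ u, a u * e u z) :=
    adm_sum Adm hAdm Finset.univ (fun u z => a u * e u z) (adm_const Adm hAdm hω hl hβ hT 0)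
      fun u _ => adm_const_mul Adm hAdm (a u) (hex u)
  have hUadm : Adm U := adm_add Adm hAdm hg hUs
  -- (1) `lap_s(U,U) ≥ 0`
  have hpos : 0 ≤ lap s U U := by
    obtain ⟨hUc, C, hC0, hUb⟩ := adm_nice hAdm hUadm
    have hϑ0 : 0 < 1 / (8 * T) := by positivity
    have h2ϑ : 2 * (1 / (8 * T)) < 1 / T := by
      rw [show 2 * (1 / (8 * T)) = 1 / (4 * T) by ring]
      exact one_div_lt_one_div_of_lt hT (by linarith)
    rw [hlap]
    simp only [hcorr]
    rw [pinnedChain_lap_self_eq_centred hω hl hβ' hγ' hN hT hϑ0 h2ϑ hUc hC0 hUb hs]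
    set m : ℝ := ∫ w, U w ∂(pinnedChain ω₂ lam β γ).gibbsMeasure N T with hm
    have hvc : Continuous fun z => U z - m := hUc.sub continuous_const
    have hvb : ∀ y, |U y - m| ≤ (C + |m|) * Real.exp ((1 / (8 * T)) * (pinnedChain ω₂ lam β γ).hamiltonian N y) :=
      fun y => by
      have h1 := hUb y
      have h2 : |m| ≤ |m| * Real.exp ((1 / (8 * T)) * (pinnedChain ω₂ lam β γ).hamiltonian N y) :=
        le_mul_of_one_le_right (abs_nonneg _)
          (Real.one_le_exp (mul_nonneg hϑ0.le (pinnedChain_hamiltonian_nonneg hω.le hl hβ γ N y)))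
      calc |U y - m| ≤ |U y| + |m| := abs_sub _ _
        _ ≤ _ := by rw [add_mul]; exact add_le_add h1 h2
    have hC1 : 0 ≤ C + |m| := by positivity
    have hge := pinnedChain_integral_mul_resolvent_ge hω hl hβ' hγ' hN hT hϑ0 h2ϑ hvc hC1 hvb hs
    have hsq : 0 ≤ s * ∫ z, (∫ t in Set.Ioi (0 : ℝ), Real.exp (-(s * t)) *
        ∫ y, (U y - m) ∂((pinnedChain ω₂ lam β γ).transitionKernel N T T t.toNNReal z)) ^ 2
        ∂(pinnedChain ω₂ lam β γ).gibbsMeasure N T :=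
      mul_nonneg hs.le (integral_nonneg fun z => sq_nonneg _)
    exact hsq.trans hge
  -- (2) `lap_s(U,U) = schur_s(g,g)` by bilinearity and `G a = -b'`
  have hexp : lap s U U = schur g g := by
    have hL1 : lap s U U = lap s g U + ∑ u, a u * lap s (e u) U := by
      rw [hU, lap_add_left hcorr hlap hFI hg hUs hUadm hs.le,
        lap_sum_left hAdm hcorr hlap hFI hω hl hβ hT Finset.univ a e (fun u _ => hex u) hUadm hs.le]
    have hR : ∀ {f : PhaseSpace N → ℝ}, Adm f → lap s f U = lap s f g + ∑ v, a v * lap s f (e v) := by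
      intro f hf
      have hfun : U = fun z => g z + (fun w => ∑ v, a v * e v w) z := rfl
      rw [hfun]
      -- additivity in the second slot via time reversal
      rw [lap_rev hlap hFI hf (adm_add Adm hAdm hg hUs)]
      have hsplit : (fun z : PhaseSpace N => g (z.1, -z.2) + (fun w : PhaseSpace N => ∑ v, a v * e v w) (z.1, -z.2)) =
          fun z => (fun w : PhaseSpace N => g (w.1, -w.2)) z +
            (fun w : PhaseSpace N => ∑ v, a v * e v (w.1, -w.2)) z := rfl
      rw [hsplit, lap_add_left hcorr hlap hFI (adm_rev Adm hAdm hg) ?_ (adm_rev Adm hAdm hf) hs.le]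
      · rw [← lap_rev hlap hFI hf hg]
        congr 1
        rw [lap_sum_left hAdm hcorr hlap hFI hω hl hβ hT Finset.univ a (fun v w => e v (w.1, -w.2))
          (fun v _ => adm_rev Adm hAdm (hex v)) (adm_rev Adm hAdm hf) hs.le]
        refine Finset.sum_congr rfl fun v _ => ?_
        rw [← lap_rev hlap hFI hf (hex v)]
      · exact adm_sum Adm hAdm Finset.univ (fun v w => a v * e v (w.1, -w.2)) (adm_const Adm hAdm hω hl hβ hT 0)
          fun v _ => adm_const_mul Adm hAdm (a v) (adm_rev Adm hAdm (hex v))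
    rw [hL1, hR hg]
    simp only [hR (hex _), ← hG]
    -- Σ_u a_u (b'_u... ) bookkeeping
    have hquad : ∑ u, a u * (lap s (e u) g + ∑ v, a v * G u v) = 0 := by
      have : ∀ u, lap s (e u) g + ∑ v, a v * G u v = 0 := fun u => by
        have h := hGa' u
        have h' : ∑ v, a v * G u v = ∑ v, G u v * a v := Finset.sum_congr rfl fun v _ => mul_comm _ _
        rw [h', h, hb']
        ring
      simp [this]
    rw [hquad, add_zero, hschur, sub_eq_add_neg, ← Finset.sum_neg_distrib]
    congr 1
    refine Finset.sum_congr rfl fun u _ => ?_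
    have hau : a u = -∑ v, G⁻¹ u v * lap s (e v) g := by
      simp [ha, hb', Matrix.mulVec, dotProduct]
    rw [hau, neg_mul, Finset.sum_mul]
    congr 1
    exact Finset.sum_congr rfl fun v _ => by ring
  rw [← hexp]
  exact hpos

end FixedN

end Summit.AtomisticToContinuum.FouriersLaw.Theorems.RobinCoercivity.Negative

end
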